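import Summits.QuantumFields.YangMills.Theorems.AlphaInputsT3ACv3StartSystem
import Summits.QuantumFields.YangMills.Theorems.AlphaInputsT3ACv3SectionCorner
import HarnessLib

/-!
# `AlphaInputsT3ACv3StartSystemCells` — START v3.1 (S5)-4b, file 3: **CELLS SEEN FROM THE TUBE CHART, AND THE ALIGNMENT LEMMA (v3.1 (i))** — (a) a chart point of the tube box of `Q` on
# the side `s` lies in the cell `cellOf Q s`; one step beyond the TOP slice (`u_λ = ⌊L^k/2⌋`) it lies in `(cellOf Q s) + e_λ`, one step below the BOTTOM slice (`u_λ = −⌊L^k/2⌋`) in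
# `(cellOf Q s) − e_λ`; (b) ★ ALIGNMENT: for a region saturated by level-`(k+1)` blocks (`L ≥ 2` automatic), if a cell `z ∈ Ω` has `z + e_λ ∉ Ω` then EVERY cell `z'` in the same
# `λ`-layer with `z' ∈ Ω` has `z' − e_λ ∈ Ω` (and the mirror statement) — «an interior edge has at most one endpoint on ∂Ω, and the other endpoint is interior» — cell `ym3-torus`,
# width seat `ym-ust-19936-w2` (g2), for the (A3 = hbox) binder

WHY (LEAD START v3.1 (i) 02:53Z; (S5)-4b OF RECORD).  The box-containment binder fails only for plaquettes straddling a cell end along the edge; such a plaquette has a corner in the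
next∕previous `λ`-layer of cells, in the continuation of the quadrant cell the active bond touches.  The quadrant rule makes that continuation MISSING when the end is on `∂Ω` (so the
plaquette is unconstrained), and the alignment lemma makes the OTHER end interior (so the plaquette is deep in a ball).  This file supplies the cell bookkeeping for both.
WHAT.  §1 `mem_iff_cellIn_coarsen` (`k`-saturation transfer), `cellOf_apply`, ★ `coarsen_boxSite_eq_cellOf` (chart point on side `s` ⇒ cell `cellOf Q s`), `chartCoord_boxSite` (chart
injectivity: the chart coordinates of a charted point are the given ones), ★ `coarsen_shift_boxSite_top` ∕ ★ `coarsen_unshift_boxSite_bot` (the layers beyond the two ends); §2 ★★ `cellIn_unshift_of_not_cellIn_shift`,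
★★ `cellIn_shift_of_not_cellIn_unshift` (alignment, from `B10StarCount.blockOf_shift` and `(k+1)`-saturation).
HONEST FRAMING.  Lattice bookkeeping; no analysis; count-neutral helper toward the (FL) row of 2′∕2′χ (`--supports stmt-QuantumFields-19936`); (A3) itself is the next file; (FL)∕`hLift`, the
stub, the crux and the gap are NOT claimed; registry untouched.  YM₃ on T³ is RUNG R3 of the programme, not the Clay problem.

References: T. Bałaban, Commun. Math. Phys. 102 (1985) 277–309 [Balaban1985Variational] ((11) p.279); [Balaban1985UV3] = Commun. Math. Phys. 102 (1985) 255–275 ((38)–(39) p.266);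
Commun. Math. Phys. 109 (1987) 249–301 [Balaban1987RG1] ((0.1), (0.3) pp.251–252).
-/

set_option autoImplicit false

noncomputable section

namespace Summit.QuantumFields.YangMills.Theorems.TubeStart

open Literature.MathematicalPhysics.QuantumFieldTheory.Balaban1983to89
open Literature.MathematicalPhysics.QuantumFieldTheory.Balaban1983to89.B10Eq38TorusDomains (toFine)
open Summit.QuantumFields.Balaban3D.Carriers
open Summit.QuantumFields.YangMills.Theorems.ModelBox

variable {P : Params} {k : ℕ}

/-! ## §1 Cells seen from the tube chart -/

/-- **SATURATION TRANSFER**: for a `k`-saturated region, `x ∈ Ω ↔ CellIn Ω k (coarsen k x)`. [cite: Balaban1985UV3, (39) p.266] -/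
theorem mem_iff_cellIn_coarsen (Ω : Set (Site P 0)) (hsat : ∀ x x' : Site P 0, coarsen k x = coarsen k x' → (x ∈ Ω ↔ x' ∈ Ω))
    (htf : ∀ z : Site P k, coarsen k (toFine k z) = z) (x : Site P 0) : x ∈ Ω ↔ CellIn Ω k (coarsen k x) :=
  hsat x (toFine k (coarsen k x)) (by rw [htf])

/-- Coordinates of the quadrant cell: `(cellOf Q s) j = y j + [j = μ ∧ ¬s.1] + [j = ν ∧ ¬s.2]`. [folklore] -/
theorem cellOf_apply (Q : Plaq P k) (s : Bool × Bool) (j : Fin P.d) :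
    cellOf Q s j = Q.src j + (if j = Q.μ ∧ s.1 = false then 1 else 0) + (if j = Q.ν ∧ s.2 = false then 1 else 0) := by
  have hne : Q.μ ≠ Q.ν := ne_of_lt Q.hμν
  obtain ⟨s1, s2⟩ := s
  unfold cellOf
  cases s1 <;> cases s2 <;> by_cases hμ : j = Q.μ <;> by_cases hν : j = Q.ν <;>
    simp_all [Site.shift, Function.update_apply]

section Chart

variable (hk : k ≤ P.m + P.K) (Q : Plaq P k) {Rt : ℕ} (hRt : Rt + 2 ≤ P.L ^ k) {u : Fin P.d → ℤ} (hu : InTube Q.μ Q.ν Rt (P.L ^ k / 2) u)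
include hk hRt hu

/-- **★ A CHART POINT ON THE SIDE `s` LIES IN THE CELL `cellOf Q s`** (`s.1 = true ↔ u_μ ≤ 0`, `s.2 = true ↔ u_ν ≤ 0`). [cite: Balaban1987RG1, (0.3) p.252] -/
theorem coarsen_boxSite_eq_cellOf (s : Bool × Bool) (h1 : if s.1 then u Q.μ ≤ 0 else 1 ≤ u Q.μ) (h2 : if s.2 then u Q.ν ≤ 0 else 1 ≤ u Q.ν) :
    coarsen k (boxSite (cornerSite k Q.src Q.μ Q.ν) u) = cellOf Q s := by
  have hne : Q.μ ≠ Q.ν := ne_of_lt Q.hμν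
  funext j
  rw [coarsen_boxSite_cornerSite_apply₂ hk Q.src Q.μ Q.ν hu hRt j, cellOf_apply]
  obtain ⟨s1, s2⟩ := s
  cases s1 <;> cases s2 <;> simp only [Bool.false_eq_true, ↓reduceIte] at h1 h2 <;> by_cases hμ : j = Q.μ <;> by_cases hν : j = Q.ν <;>
    simp_all <;> omega

/-- **THE TOP SLICE IS LAST ALONG `λ`**: a chart point with `u_λ = ⌊L^k/2⌋` (`λ` longitudinal) is the last site of its cell in direction `λ`. [cite: Balaban1987RG1, (0.3) p.252] -/
theorem isLast_boxSite_of_top {i : Fin P.d} (hi : ¬ (i = Q.μ ∨ i = Q.ν)) (htop : u i = (P.L ^ k / 2 : ℕ)) : IsLast k (boxSite (cornerSite k Q.src Q.μ Q.ν) u) i :=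
  (isLast_boxSite_cornerSite_iff₂ hk Q.src Q.μ Q.ν hu hRt i).mpr (Or.inr ⟨hi, htop⟩)

/-- **★ ONE STEP BEYOND THE TOP SLICE LIES IN THE NEXT CELL**: for a chart point on side `s` with `u_λ = ⌊L^k/2⌋`, `coarsen k ((c + u) + e_λ) = (cellOf Q s) + e_λ`. [cite: Balaban1987RG1, (0.3) p.252] -/
theorem coarsen_shift_boxSite_top (s : Bool × Bool) (h1 : if s.1 then u Q.μ ≤ 0 else 1 ≤ u Q.μ) (h2 : if s.2 then u Q.ν ≤ 0 else 1 ≤ u Q.ν)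
    {i : Fin P.d} (hi : ¬ (i = Q.μ ∨ i = Q.ν)) (htop : u i = (P.L ^ k / 2 : ℕ)) :
    coarsen k ((boxSite (cornerSite k Q.src Q.μ Q.ν) u).shift i) = (cellOf Q s).shift i := by
  rw [coarsen_shift_of_last k hk _ i (isLast_boxSite_of_top hk Q hRt hu hi htop), coarsen_boxSite_eq_cellOf hk Q hRt hu s h1 h2]

omit hRt in
/-- **THE BOTTOM SLICE IS FIRST ALONG `λ`**: a chart point with `u_λ = −⌊L^k/2⌋` has in-cell position `0` in direction `λ`. [cite: Balaban1987RG1, (0.3) p.252] -/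
theorem val_mod_boxSite_of_bot {i : Fin P.d} (hi : ¬ (i = Q.μ ∨ i = Q.ν)) (hbot : u i = -((P.L ^ k / 2 : ℕ) : ℤ)) :
    ((boxSite (cornerSite k Q.src Q.μ Q.ν) u) i).val % P.L ^ k = 0 := by
  obtain ⟨t, ht, htL, hx⟩ := corner_longitudinal₂ Q.src Q.μ Q.ν hu hi
  have ht0 : t = 0 := by omega
  subst ht0
  exact (val_mod_div_of_eq_cast hk htL hx).1

omit hRt hu in
/-- If `x` is the first site of its cell along `λ`, then `x − e_λ` is the last site of the previous cell. [cite: Balaban1987RG1, (0.3) p.252] -/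
theorem isLast_unshift_of_first (x : Site P 0) (i : Fin P.d) (h0 : (x i).val % P.L ^ k = 0) : IsLast k (unshift x i) i := by
  have hLk : 0 < P.L ^ k := pow_pos P.L_pos k
  -- the finest period is a multiple of `L^k`
  have hN : P.sitesPerDir 0 = P.L ^ k * P.sitesPerDir k := by
    unfold Params.sitesPerDir
    have h : P.m + P.K - 0 = k + (P.m + P.K - k) := by omega
    rw [h, pow_add]; ring
  unfold IsLast
  have hu : (unshift x i) i = x i - 1 := by simp [unshift]
  rw [hu]
  haveI : NeZero (P.sitesPerDir 0) := ⟨P.sitesPerDir_ne_zero 0⟩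
  set M : ℤ := ((P.L ^ k : ℕ) : ℤ) with hM
  have hM1 : (1 : ℤ) ≤ M := by rw [hM]; exact_mod_cast hLk
  -- integer representative of `x i − 1`
  have hval : (((x i - 1 : ZMod (P.sitesPerDir 0)).val : ℤ)) = (((x i).val : ℤ) - 1) % (P.sitesPerDir 0 : ℤ) := by
    have e : (x i - 1 : ZMod (P.sitesPerDir 0)) = ((((x i).val : ℤ) - 1 : ℤ) : ZMod (P.sitesPerDir 0)) := by
      push_cast; rw [ZMod.natCast_zmod_val]
    rw [e, ZMod.val_intCast]
  have hdvd : M ∣ (P.sitesPerDir 0 : ℤ) := ⟨P.sitesPerDir k, by rw [hM]; exact_mod_cast hN⟩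
  have hx0 : ((x i).val : ℤ) % M = 0 := by rw [hM]; exact_mod_cast h0
  have hmodZ : (((x i - 1 : ZMod (P.sitesPerDir 0)).val : ℤ)) % M = M - 1 := by
    rw [hval, Int.emod_emod_of_dvd _ hdvd, Int.sub_emod, hx0]
    rcases eq_or_lt_of_le hM1 with hM' | hM'
    · rw [← hM']; norm_num
    · rw [Int.emod_eq_of_lt zero_le_one hM']
      have e : (0 : ℤ) - 1 = (M - 1) + M * (-1) := by ring
      rw [e, Int.add_mul_emod_self_left]
      exact Int.emod_eq_of_lt (by linarith) (by linarith)
  rw [hM] at hmodZ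
  have h1 : 1 ≤ P.L ^ k := hLk
  omega

/-- **★ ONE STEP BELOW THE BOTTOM SLICE LIES IN THE PREVIOUS CELL**: for a chart point on side `s` with `u_λ = −⌊L^k/2⌋`, `coarsen k ((c + u) − e_λ) = (cellOf Q s) − e_λ`. [cite: Balaban1987RG1, (0.3) p.252] -/
theorem coarsen_unshift_boxSite_bot (s : Bool × Bool) (h1 : if s.1 then u Q.μ ≤ 0 else 1 ≤ u Q.μ) (h2 : if s.2 then u Q.ν ≤ 0 else 1 ≤ u Q.ν)
    {i : Fin P.d} (hi : ¬ (i = Q.μ ∨ i = Q.ν)) (hbot : u i = -((P.L ^ k / 2 : ℕ) : ℤ)) :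
    coarsen k (unshift (boxSite (cornerSite k Q.src Q.μ Q.ν) u) i) = unshift (cellOf Q s) i := by
  have hlast : IsLast k (unshift (boxSite (cornerSite k Q.src Q.μ Q.ν) u) i) i := isLast_unshift_of_first hk _ i (val_mod_boxSite_of_bot hk Q hu hi hbot)
  have h := coarsen_shift_of_last k hk _ i hlast
  rw [shift_unshift, coarsen_boxSite_eq_cellOf hk Q hRt hu s h1 h2] at h
  rw [← unshift_shift (coarsen k (unshift (boxSite (cornerSite k Q.src Q.μ Q.ν) u) i)) i, ← h]

end Chart

/-! ## §2 The alignment lemma (START v3.1 (i)) -/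

section Align

variable (Ω : Set (Site P 0)) (hk1 : k + 1 ≤ P.m + P.K) (hsat1 : ∀ z z' : Site P k, blockOf z = blockOf z' → (CellIn Ω k z ↔ CellIn Ω k z'))
include hk1 hsat1

/-- If `z ∈ Ω` but `z + e_λ ∉ Ω` then `z` is the LAST cell of its `(k+1)`-block along `λ`. [cite: Balaban1985UV3, (39) p.266] -/
theorem mod_eq_of_cellIn_not_shift {z : Site P k} {i : Fin P.d} (hz : CellIn Ω k z) (hzs : ¬ CellIn Ω k (z.shift i)) : (z i).val % P.L + 1 = P.L := by
  by_contra h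
  have hb : blockOf (z.shift i) = blockOf z := by rw [B10StarCount.blockOf_shift hk1 z i, if_neg h]
  exact hzs ((hsat1 _ _ hb).mpr hz)

/-- If `z ∈ Ω` but `z − e_λ ∉ Ω` then `z` is the FIRST cell of its `(k+1)`-block along `λ` (`(z − e_λ)` is last). [cite: Balaban1985UV3, (39) p.266] -/
theorem mod_eq_of_cellIn_not_unshift {z : Site P k} {i : Fin P.d} (hz : CellIn Ω k z) (hzu : ¬ CellIn Ω k (unshift z i)) : ((unshift z i) i).val % P.L + 1 = P.L := by
  by_contra h
  have hb : blockOf ((unshift z i).shift i) = blockOf (unshift z i) := by rw [B10StarCount.blockOf_shift hk1 _ i, if_neg h]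
  rw [shift_unshift] at hb
  exact hzu ((hsat1 _ _ hb).mp hz)

omit hsat1 in
/-- Last along `λ` implies the predecessor is not last (`L ≥ 2`): `((z − e_λ) λ) mod L + 1 ≠ L` when `(z λ) mod L + 1 = L`. [folklore] -/
theorem not_last_unshift_of_last {z : Site P k} {i : Fin P.d} (h : (z i).val % P.L + 1 = P.L) : ¬ (((unshift z i) i).val % P.L + 1 = P.L) := by
  have hL : 1 < P.L := P.hL.2
  have hu : (unshift z i) i = z i - 1 := by simp [unshift]
  have hv1 : 1 ≤ (z i).val := by
    by_contra h0; push Not at h0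
    have : (z i).val = 0 := by omega
    rw [this, Nat.zero_mod] at h; omega
  haveI : NeZero (P.sitesPerDir k) := ⟨P.sitesPerDir_ne_zero k⟩
  have hval : (z i - 1).val = (z i).val - 1 := by
    have h1 : (1 : ZMod (P.sitesPerDir k)).val = 1 := by
      rw [ZMod.val_one_eq_one_mod]
      exact Nat.mod_eq_of_lt (by rw [P.sitesPerDir_eq_mul_succ hk1]; have := Nat.pos_of_ne_zero (P.sitesPerDir_ne_zero (k + 1)); nlinarith)
    rw [ZMod.val_sub (by rw [h1]; exact hv1), h1]
  rw [hu, hval]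
  intro h'
  -- `(v − 1) mod L = L − 1` and `v mod L = L − 1` are incompatible for `L ≥ 2`
  have hw : (z i).val = ((z i).val - 1) + 1 := by omega
  have hmod : (((z i).val - 1) + 1) % P.L = 0 := by
    rw [Nat.add_mod, show ((z i).val - 1) % P.L = P.L - 1 by omega, Nat.mod_eq_of_lt hL, Nat.sub_add_cancel hL.le, Nat.mod_self]
  rw [← hw] at hmod
  omega

omit hsat1 in
/-- First along `λ` (predecessor last) implies not last (`L ≥ 2`). [folklore] -/
theorem not_last_of_unshift_last {z : Site P k} {i : Fin P.d} (h : ((unshift z i) i).val % P.L + 1 = P.L) : ¬ ((z i).val % P.L + 1 = P.L) :=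
  fun h' => not_last_unshift_of_last hk1 h' h

/-- **★★ ALIGNMENT (i), FORWARD-MISSING ⇒ BACKWARD-PRESENT**: if a cell `z ∈ Ω` has `z + e_λ ∉ Ω`, then every cell `z'` of `Ω` in the same `λ`-layer (`z' λ = z λ`) has `z' − e_λ ∈ Ω`.
[cite: Balaban1985UV3, (39) p.266] -/
theorem cellIn_unshift_of_not_cellIn_shift {z z' : Site P k} {i : Fin P.d} (hz : CellIn Ω k z) (hzs : ¬ CellIn Ω k (z.shift i)) (hzz' : z' i = z i)
    (hz' : CellIn Ω k z') : CellIn Ω k (unshift z' i) := by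
  have hlast : (z' i).val % P.L + 1 = P.L := by rw [hzz']; exact mod_eq_of_cellIn_not_shift Ω hk1 hsat1 hz hzs
  have hb : blockOf ((unshift z' i).shift i) = blockOf (unshift z' i) := by
    rw [B10StarCount.blockOf_shift hk1 _ i, if_neg (not_last_unshift_of_last hk1 hlast)]
  rw [shift_unshift] at hb
  exact (hsat1 _ _ hb).mp hz'

/-- **★★ ALIGNMENT (i), BACKWARD-MISSING ⇒ FORWARD-PRESENT**: if a cell `z ∈ Ω` has `z − e_λ ∉ Ω`, then every cell `z'` of `Ω` in the same `λ`-layer has `z' + e_λ ∈ Ω`.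
[cite: Balaban1985UV3, (39) p.266] -/
theorem cellIn_shift_of_not_cellIn_unshift {z z' : Site P k} {i : Fin P.d} (hz : CellIn Ω k z) (hzu : ¬ CellIn Ω k (unshift z i)) (hzz' : z' i = z i)
    (hz' : CellIn Ω k z') : CellIn Ω k (z'.shift i) := by
  have hfirst : ((unshift z i) i).val % P.L + 1 = P.L := mod_eq_of_cellIn_not_unshift Ω hk1 hsat1 hz hzu
  have hfirst' : ((unshift z' i) i).val % P.L + 1 = P.L := by
    have e : (unshift z' i) i = (unshift z i) i := by simp [unshift, hzz']
    rw [e]; exact hfirst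
  have hb : blockOf (z'.shift i) = blockOf z' := by
    rw [B10StarCount.blockOf_shift hk1 z' i, if_neg (not_last_of_unshift_last hk1 hfirst')]
  exact (hsat1 _ _ hb).mpr hz'

end Align

end Summit.QuantumFields.YangMills.Theorems.TubeStart

end
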